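import Summits.Ventures.HodgeRepro2.T5SchurMathlib

/-!
# Haar measure on a compact group: uniqueness, right-invariance, inversion-invariance

Tier-5 support (N4.3 = (R3), route/T5-SUPPORT-p1.md §S4.6 — the «Schur orthogonality» row's
last column «the uniqueness of the invariant measure (any left-invariant probability measure is
admitted)», and the «unimodular» sentences of N4.3 / B1 for COMPACT groups).  For a compact
Hausdorff group `G` with its normalised Haar measure `haarProb G = haarMeasure ⊤`
(`T5SchurMathlib`):

* the instances: `haarProb G` is a regular Haar measure (a left-invariant probability measure by
  `T5SchurMathlib`);
* `eq_haarProb_of_isMulLeftInvariant`: EVERY left-invariant probability measure on `G` equals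
  `haarProb G` (Mathlib's `isMulInvariant_eq_smul_of_compactSpace`, scalar `1` by evaluating at
  `univ`) — so the «normalised invariant measure» of the Schur relations is unique;
* `isMulRightInvariant_haarProb` / `isInvInvariant_haarProb`: `haarProb G` is also
  right-invariant and inversion-invariant — a compact group is UNIMODULAR — and hence so is
  every left-invariant probability measure (`isMulRightInvariant_of_isMulLeftInvariant`,
  `isInvInvariant_of_isMulLeftInvariant`); `integral_mul_right_haarProb` /
  `integral_inv_haarProb` are the integral forms.

What this file does NOT say: anything about NON-compact groups (the unimodularity of `U(1,1)` /
of a reductive `p`-adic group stays the [C] input of N4.3 / B1); nothing about `(N)`.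

Blind lane: Mathlib + own prefix; no sorry; axioms ⊆ {propext, Classical.choice, Quot.sound}.
-/

namespace Summit.Ventures.HodgeRepro2.T5HaarUniqueCompact

open MeasureTheory Measure Summit.Ventures.HodgeRepro2.T5SchurMathlib

variable {G : Type*} [Group G] [TopologicalSpace G] [IsTopologicalGroup G] [MeasurableSpace G]
  [BorelSpace G] [CompactSpace G] [T2Space G]

/-- `haarProb G` is `haarMeasure ⊤` (its probability and left-invariance instances are in
`T5SchurMathlib`). -/
lemma haarProb_def : haarProb G = haarMeasure ⊤ := rfl

/-- `haarProb G` is a Haar measure. -/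
instance isHaarMeasure_haarProb : (haarProb G).IsHaarMeasure := by
  rw [haarProb_def]; infer_instance

/-- `haarProb G` is regular. -/
instance regular_haarProb : (haarProb G).Regular := by
  rw [haarProb_def]; infer_instance

/-- **Uniqueness**: every left-invariant probability measure on a compact group is the
normalised Haar measure. -/
theorem eq_haarProb_of_isMulLeftInvariant (μ : Measure G) [IsProbabilityMeasure μ]
    [μ.IsMulLeftInvariant] : μ = haarProb G := by
  have h := isMulInvariant_eq_smul_of_compactSpace μ (haarProb G)
  have hu := congrArg (fun ν : Measure G => ν Set.univ) h
  simp only [measure_univ, Measure.smul_apply] at hu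
  have hc : haarScalarFactor μ (haarProb G) = 1 := by
    have : ((haarScalarFactor μ (haarProb G) : NNReal) : ENNReal) = 1 := by
      simpa [ENNReal.smul_def] using hu.symm
    exact_mod_cast this
  rw [h, hc, one_smul]

/-- **Unimodularity**: the normalised Haar measure of a compact group is right-invariant. -/
theorem isMulRightInvariant_haarProb : (haarProb G).IsMulRightInvariant := by
  refine ⟨fun g => ?_⟩
  haveI : IsProbabilityMeasure (map (· * g) (haarProb G)) :=
    isProbabilityMeasure_map (measurable_mul_const g).aemeasurable
  exact eq_haarProb_of_isMulLeftInvariant (map (· * g) (haarProb G))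

/-- The instance form of `isMulRightInvariant_haarProb`. -/
instance : (haarProb G).IsMulRightInvariant := isMulRightInvariant_haarProb

/-- **Inversion-invariance** of the normalised Haar measure of a compact group. -/
theorem isInvInvariant_haarProb : (haarProb G).IsInvInvariant := by
  refine ⟨?_⟩
  haveI : IsProbabilityMeasure (haarProb G).inv :=
    isProbabilityMeasure_map measurable_inv.aemeasurable
  exact eq_haarProb_of_isMulLeftInvariant (haarProb G).inv

/-- The instance form of `isInvInvariant_haarProb`. -/
instance : (haarProb G).IsInvInvariant := isInvInvariant_haarProb

/-- Every left-invariant probability measure on a compact group is right-invariant. -/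
theorem isMulRightInvariant_of_isMulLeftInvariant (μ : Measure G) [IsProbabilityMeasure μ]
    [μ.IsMulLeftInvariant] : μ.IsMulRightInvariant := by
  rw [eq_haarProb_of_isMulLeftInvariant μ]; infer_instance

/-- Every left-invariant probability measure on a compact group is inversion-invariant. -/
theorem isInvInvariant_of_isMulLeftInvariant (μ : Measure G) [IsProbabilityMeasure μ]
    [μ.IsMulLeftInvariant] : μ.IsInvInvariant := by
  rw [eq_haarProb_of_isMulLeftInvariant μ]; infer_instance

/-- Right-translation invariance of integrals against `haarProb G`. -/
theorem integral_mul_right_haarProb {E : Type*} [NormedAddCommGroup E] [NormedSpace ℝ E]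
    (f : G → E) (g : G) : ∫ x, f (x * g) ∂haarProb G = ∫ x, f x ∂haarProb G :=
  integral_mul_right_eq_self f g

/-- Left-translation invariance of integrals against `haarProb G`. -/
theorem integral_mul_left_haarProb {E : Type*} [NormedAddCommGroup E] [NormedSpace ℝ E]
    (f : G → E) (g : G) : ∫ x, f (g * x) ∂haarProb G = ∫ x, f x ∂haarProb G :=
  integral_mul_left_eq_self f g

/-- Inversion invariance of integrals against `haarProb G`. -/
theorem integral_inv_haarProb {E : Type*} [NormedAddCommGroup E] [NormedSpace ℝ E]
    (f : G → E) : ∫ x, f x⁻¹ ∂haarProb G = ∫ x, f x ∂haarProb G :=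
  integral_inv_eq_self f (haarProb G)

end Summit.Ventures.HodgeRepro2.T5HaarUniqueCompact
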